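import Literature.NumberTheory.NumberFields.RayClassFieldLocalTowerNorm
import Literature.NumberTheory.NumberFields.RayClassFieldLocalFrobeniusDegree
import Literature.NumberTheory.GaloisRepresentations.LocalUnramifiedLevelUnique
import HarnessLib

/-!
# GLOBAL NORMS ARE LOCAL NORMS in the UNRAMIFIED direction of the two-variable tower:
# `ι(N_{K(𝔪'v^{n+1})/K(𝔪v^{n+1})} x) = N_{E'·K_π^{n+1}/E·K_π^{n+1}}(ι x)` for `𝔪' ⊆ 𝔪`, `E ≤ E'` — de Shalit II.4.14 / III.1.2 (2)

Sequel of `RayClassFieldLocalTowerNorm.lean` (the `v`-direction `K(𝔪v^{n+1}) ≤ K(𝔪v^{m+1})` ↔ `E·K_π^{n+1} ≤ E·K_π^{m+1}`).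
De Shalit's TWO-variable towers `K(𝔤𝔭̄^{m+1}𝔭^{k+1})` (II.4.14, III.1.1) also grow in the direction of the modulus PRIME TO `𝔭`
(`𝔪 = 𝔤𝔭̄^{m+1} ↦ 𝔪' = 𝔤𝔭̄^{m+2}`); completed at a prime `𝔓 ∣ 𝔭` this is the UNRAMIFIED direction `E ↦ E'` of the local tower
`E·K_π^{k+1}`.  THIS file proves the corresponding norm compatibility — the input that makes a doubly norm-coherent family of
GLOBAL units (two-variable elliptic units) a `baseNorm`-coherent family of the tree's `RelNormCoherentUnits hπ (E m)` — under
the one hypothesis that distinguishes the unramified direction from the totally ramified one: the step must be INERT at `𝔓`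
(`E' ⊆ K_v·ι(K(𝔪'))`, Galois form), together with the degree count `[K(𝔪'v^{n+1}) : K(𝔪v^{n+1})]·[E:K_v] ≤ [E':K_v]`.

* §1 ★ `card_filter_fixing_mul_finrank` — pure Galois theory: for `E₁ ≤ E₂ ⊆ F̄`, `E₂/F` finite Galois,
  `#{σ ∈ Gal(E₂/F) : σ|_{E₁} = id}·[E₁:F] = [E₂:F]`;
* §2 ★ `exists_absRestrictNormalHom_eq_of_card_le` — (SURJ) from (INJ) by counting: if every `τ ∈ Γ_{K_v}` fixing `M₀` and
  `ι(L)` fixes `M` and `#Gal(L/L₀) ≤ #Gal(M/M₀)`, every `ρ ∈ Gal(L/L₀)` is `(res τ)|_L` for a `τ` fixing `M₀`;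
  ★ `absClosureEmbedding_towerNorm_eq_towerNorm_of_card_le` — `ι(N_{L/L₀} x) = N_{M/M₀}(ι x)` from (INJ) and the count;
* §3 ★ `mem_fixingSubgroup_of_forall_smul_absClosureEmbedding_eq_of_finrank_dvd_orderOf` — THE INERT CRITERION: if
  `[E':K_v] ∣ ord(Frob_v ∈ Gal(K(𝔪')/K))` (`E' ≤ K_v^{nr}` finite), every `τ ∈ Γ_{K_v}` fixing `ι(K(𝔪'))` pointwise fixes `E'`
  (Weil elements: `orderOf_frob_dvd_deg` + `mem_fieldSubgroup_iff_dvd_deg_of_le_maxUnramified`; density of `W_{K_v}` in `Γ_{K_v}`);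
* §4 ★★ `absClosureEmbedding_towerNorm_rayClassField_unramified_eq` — **THE NORM COMPATIBILITY in the unramified direction**
  for `K(𝔪v^{n+1}) ≤ K(𝔪'v^{n+1})` (`𝔪' ≤ 𝔪`, same uniformiser `π`, `α = π^f ≡ 1 mod 𝔪`, `α' = π^{f'} ≡ 1 mod 𝔪'`) and
  `E·K_π^{n+1} ≤ E'·K_π^{n+1}` (`E ≤ E' ≤ K_v^{nr}`), GIVEN the inert hypothesis and the degree count;
  ★★ `absClosureEmbedding_towerNorm_rayClassField_unramified_eq_of_finrank_dvd_orderOf` — the same with the inert hypothesis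
  discharged by §3.

Theorems only; no `sorry`; no new definitions.

## References
* [deShalit1987] E. de Shalit, *Iwasawa theory of elliptic curves with complex multiplication* (1987), II.1.10 (p. 39),
  II.4.14 Step 1 (p. 71), III.1.1–1.2 (2) (p. 88–89, 101).
* [NeukirchANT1999] J. Neukirch, *Algebraic Number Theory* (1999), Ch. VI §5 Prop. (5.6), §7 Cor. (7.3), Ch. IV §1 (1.2), §4.
* [Corvallis1979] J. Tate, *Number theoretic background* (1979), (1.4.1) (`W_F` dense in `Γ_F`).
-/

noncomputable section

open NumberField IsDedekindDomain IsDedekindDomain.HeightOneSpectrum Field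
open scoped nonZeroDivisors Classical

namespace Literature.NumberTheory.NumberFields

open Literature.NumberTheory.GaloisRepresentations
open Literature.NumberTheory.GaloisRepresentations.ArtinLocalGlobal
open Literature.NumberTheory.GaloisRepresentations.IsNonarchimedeanLocalField

/-! ### §1. Counting the relative automorphisms (pure Galois theory) -/

section Count

variable {F : Type*} [Field F] {E₁ E₂ : IntermediateField F (AlgebraicClosure F)}

/-- ★ **`#{σ ∈ Gal(E₂/F) : σ|_{E₁} = id} · [E₁:F] = [E₂:F]`** for `E₁ ≤ E₂ ⊆ F̄` with `E₂/F` finite Galois: the automorphisms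
fixing `E₁` are the `E₁`-automorphisms (`restrictScalars`), `#Aut_{E₁}(E₂) = [E₂:E₁]` (`E₂/E₁` Galois) and the tower law.
[cite: NeukirchANT1999, Ch. IV §1 (1.2)] -/
theorem card_filter_fixing_mul_finrank [FiniteDimensional F E₂] [IsGalois F E₂] (h : E₁ ≤ E₂) :
    (Finset.univ.filter (fun σ : E₂ ≃ₐ[F] E₂ =>
        ∀ y : E₁, σ (IntermediateField.inclusion h y) = IntermediateField.inclusion h y)).card *
      Module.finrank F E₁ = Module.finrank F E₂ := by
  letI := towerAlgebra h
  haveI := towerAlgebra_isScalarTower h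
  haveI : FiniteDimensional E₁ E₂ := FiniteDimensional.right F E₁ E₂
  haveI : IsGalois E₁ E₂ := IsGalois.tower_top_of_isGalois F E₁ E₂
  haveI : FiniteDimensional F E₁ :=
    Module.Finite.of_injective (IntermediateField.inclusion h).toLinearMap (IntermediateField.inclusion_injective h)
  haveI : Module.Free F E₁ := Module.Free.of_divisionRing F E₁
  haveI : Module.Free E₁ E₂ := Module.Free.of_divisionRing E₁ E₂
  -- the filter set is the image of `Aut_{E₁}(E₂)` under `restrictScalars F`
  have himg : Finset.univ.filter (fun σ : E₂ ≃ₐ[F] E₂ =>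
        ∀ y : E₁, σ (IntermediateField.inclusion h y) = IntermediateField.inclusion h y) =
      (Finset.univ : Finset (E₂ ≃ₐ[E₁] E₂)).image (AlgEquiv.restrictScalars F) := by
    ext σ
    rw [Finset.mem_filter, Finset.mem_image]
    constructor
    · rintro ⟨-, hσ⟩
      exact ⟨{ σ with commutes' := fun y => hσ y }, Finset.mem_univ _, AlgEquiv.ext fun z => rfl⟩
    · rintro ⟨τ, -, rfl⟩
      exact ⟨Finset.mem_univ _, fun y => τ.commutes y⟩
  rw [himg, Finset.card_image_of_injective _ (AlgEquiv.restrictScalars_injective F), Finset.card_univ,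
    ← Nat.card_eq_fintype_card, IsGalois.card_aut_eq_finrank, mul_comm, Module.finrank_mul_finrank]

end Count

/-! ### §2. (SURJ) from (INJ) by counting; the norm compatibility from (INJ) and the count -/

variable {K : Type} [Field K] [NumberField K] {𝔪 𝔪' : Ideal (𝓞 K)} {v : HeightOneSpectrum (𝓞 K)}

omit [NumberField K] in
/-- `((τ|_L) x : K̄) = τ • x`. [folklore] -/
private theorem coe_absRestrictNormalHom_apply₁₂ (L : IntermediateField K (AlgebraicClosure K)) [Normal K L]
    (τ : absoluteGaloisGroup K) (x : L) :
    ((absRestrictNormalHom L τ x : L) : AlgebraicClosure K) = τ • (x : AlgebraicClosure K) :=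
  AlgEquiv.restrictNormalHom_apply L _ x

omit [NumberField K] in
/-- An element of `Γ_K` fixing `L` pointwise lies in `ker (res_L)`. [folklore] -/
private theorem mem_ker_absRestrictNormalHom_of_forall_smul_eq₁₂ (L : IntermediateField K (AlgebraicClosure K))
    [Normal K L] {τ : absoluteGaloisGroup K} (h : ∀ x ∈ L, τ • x = x) : τ ∈ (absRestrictNormalHom L).ker := by
  rw [MonoidHom.mem_ker]
  ext x
  rw [coe_absRestrictNormalHom_apply₁₂, AlgEquiv.one_apply]
  exact h x x.2

/-- ★ **(SURJ) from (INJ) by counting**: `L₀ ≤ L ⊆ K̄` (`L/K` finite Galois), `M₀ ≤ M ⊆ K̄_v` (`M/K_v` finite Galois),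
`ι(L) ⊆ M`, `ι(L₀) ⊆ M₀`; if every `τ ∈ Γ_{K_v}` fixing `M₀` and `ι(L)` pointwise fixes `M` (INJ) and
`#{ρ ∈ Gal(L/K) : ρ|_{L₀} = id} ≤ #{σ ∈ Gal(M/K_v) : σ|_{M₀} = id}`, then every `ρ ∈ Gal(L/K)` fixing `L₀` is `(res τ)|_L` for
some `τ ∈ Γ_{K_v}` fixing `M₀` (the restriction `σ ↦ (res σ̃)|_L` is injective on the automorphisms fixing `M₀`, hence onto
by cardinality). [cite: NeukirchANT1999, Ch. IV §1 (1.2)] [cite: deShalit1987, III.1.2 (2) (p. 101)] -/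
theorem exists_absRestrictNormalHom_eq_of_card_le
    (L₀ L : IntermediateField K (AlgebraicClosure K)) [FiniteDimensional K L] [IsGalois K L] (hL : L₀ ≤ L)
    (M₀ M : IntermediateField (v.adicCompletion K) (AlgebraicClosure (v.adicCompletion K)))
    [FiniteDimensional (v.adicCompletion K) M] [IsGalois (v.adicCompletion K) M] (hM : M₀ ≤ M)
    (hιL : ∀ y : AlgebraicClosure K, y ∈ L → absClosureEmbedding K (v.adicCompletion K) y ∈ M)
    (hιL₀ : ∀ y : AlgebraicClosure K, y ∈ L₀ → absClosureEmbedding K (v.adicCompletion K) y ∈ M₀)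
    (hinj : ∀ τ : absoluteGaloisGroup (v.adicCompletion K), τ ∈ M₀.fixingSubgroup →
      (∀ y ∈ L, τ • absClosureEmbedding K (v.adicCompletion K) y = absClosureEmbedding K (v.adicCompletion K) y) →
        τ ∈ M.fixingSubgroup)
    (hcard : (Finset.univ.filter (fun ρ : L ≃ₐ[K] L =>
        ∀ y : L₀, ρ (IntermediateField.inclusion hL y) = IntermediateField.inclusion hL y)).card ≤
      (Finset.univ.filter (fun σ : M ≃ₐ[v.adicCompletion K] M =>
        ∀ y : M₀, σ (IntermediateField.inclusion hM y) = IntermediateField.inclusion hM y)).card)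
    (ρ : L ≃ₐ[K] L) (hρ : ∀ y : L, (y : AlgebraicClosure K) ∈ L₀ → ((ρ y : L) : AlgebraicClosure K) = y) :
    ∃ τ : absoluteGaloisGroup (v.adicCompletion K),
      absRestrictNormalHom L (absGaloisRestrict K (v.adicCompletion K) τ) = ρ ∧ τ ∈ M₀.fixingSubgroup := by
  haveI hMn : Normal (v.adicCompletion K) M := IsGalois.to_normal
  haveI hLn : Normal K L := IsGalois.to_normal
  -- the restriction map `r σ = (res σ̃)|_L` and its defining identity
  set r : (M ≃ₐ[v.adicCompletion K] M) → (L ≃ₐ[K] L) := fun σ =>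
    absRestrictNormalHom L (absGaloisRestrict K (v.adicCompletion K)
      ((absoluteGaloisGroup.toAlgEquiv (v.adicCompletion K)).symm (σ.liftNormal (AlgebraicClosure (v.adicCompletion K)))))
    with hr_def
  have hr : ∀ (σ : M ≃ₐ[v.adicCompletion K] M) (y : L),
      absClosureEmbedding K (v.adicCompletion K) ((r σ y : L) : AlgebraicClosure K) =
        ((σ ⟨absClosureEmbedding K (v.adicCompletion K) y, hιL y y.2⟩ : M) : AlgebraicClosure (v.adicCompletion K)) :=
    fun σ y ↦ absClosureEmbedding_absRestrictNormalHom_absGaloisRestrict_liftNormal_apply L M σ y (hιL y y.2)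
  have hfix₀ : ∀ (σ : M ≃ₐ[v.adicCompletion K] M),
      (∀ y : M₀, σ (IntermediateField.inclusion hM y) = IntermediateField.inclusion hM y) →
      ∀ z : AlgebraicClosure (v.adicCompletion K), z ∈ M₀ →
        (absoluteGaloisGroup.toAlgEquiv (v.adicCompletion K)).symm
          (σ.liftNormal (AlgebraicClosure (v.adicCompletion K))) • z = z := by
    intro σ hσ z hz
    have h := toAlgEquiv_symm_liftNormal_smul_coe M σ (IntermediateField.inclusion hM ⟨z, hz⟩)
    rw [hσ ⟨z, hz⟩, IntermediateField.coe_inclusion] at h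
    exact h
  set SM := Finset.univ.filter (fun σ : M ≃ₐ[v.adicCompletion K] M =>
      ∀ y : M₀, σ (IntermediateField.inclusion hM y) = IntermediateField.inclusion hM y) with hSM
  set SL := Finset.univ.filter (fun ρ : L ≃ₐ[K] L =>
      ∀ y : L₀, ρ (IntermediateField.inclusion hL y) = IntermediateField.inclusion hL y) with hSL
  -- `r` maps `SM` into `SL`
  have hmaps : ∀ σ ∈ SM, r σ ∈ SL := by
    intro σ hσ
    rw [hSM, Finset.mem_filter] at hσ
    rw [hSL, Finset.mem_filter]
    refine ⟨Finset.mem_univ _, fun y ↦ Subtype.ext ((absClosureEmbedding K (v.adicCompletion K)).injective ?_)⟩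
    have e1 : (⟨absClosureEmbedding K (v.adicCompletion K) ((IntermediateField.inclusion hL y : L) : AlgebraicClosure K),
        hιL _ (IntermediateField.inclusion hL y).2⟩ : M) =
        IntermediateField.inclusion hM ⟨absClosureEmbedding K (v.adicCompletion K) y, hιL₀ y y.2⟩ :=
      Subtype.ext rfl
    have h : absClosureEmbedding K (v.adicCompletion K) ((r σ (IntermediateField.inclusion hL y) : L) : AlgebraicClosure K) =
        absClosureEmbedding K (v.adicCompletion K) ((IntermediateField.inclusion hL y : L) : AlgebraicClosure K) := by
      rw [hr σ, e1, hσ.2, IntermediateField.coe_inclusion, IntermediateField.coe_inclusion]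
    exact h
  -- `r` is injective on `SM` (by (INJ))
  have hinjr : ∀ σ₁ ∈ SM, ∀ σ₂ ∈ SM, r σ₁ = r σ₂ → σ₁ = σ₂ := by
    intro σ₁ hσ₁ σ₂ hσ₂ h12
    rw [hSM, Finset.mem_filter] at hσ₁ hσ₂
    have hτ₀ : ((absoluteGaloisGroup.toAlgEquiv (v.adicCompletion K)).symm
        (σ₂.liftNormal (AlgebraicClosure (v.adicCompletion K))))⁻¹ *
        (absoluteGaloisGroup.toAlgEquiv (v.adicCompletion K)).symm
          (σ₁.liftNormal (AlgebraicClosure (v.adicCompletion K))) ∈ M₀.fixingSubgroup := by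
      refine (IntermediateField.mem_fixingSubgroup_iff _ _).mpr fun z hz ↦ ?_
      change (((absoluteGaloisGroup.toAlgEquiv (v.adicCompletion K)).symm
        (σ₂.liftNormal (AlgebraicClosure (v.adicCompletion K))))⁻¹ *
        (absoluteGaloisGroup.toAlgEquiv (v.adicCompletion K)).symm
          (σ₁.liftNormal (AlgebraicClosure (v.adicCompletion K)))) • z = z
      rw [mul_smul, hfix₀ σ₁ hσ₁.2 z hz, inv_smul_eq_iff, hfix₀ σ₂ hσ₂.2 z hz]
    have hτfix : ∀ y ∈ L, (((absoluteGaloisGroup.toAlgEquiv (v.adicCompletion K)).symm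
        (σ₂.liftNormal (AlgebraicClosure (v.adicCompletion K))))⁻¹ *
        (absoluteGaloisGroup.toAlgEquiv (v.adicCompletion K)).symm
          (σ₁.liftNormal (AlgebraicClosure (v.adicCompletion K)))) • absClosureEmbedding K (v.adicCompletion K) y =
        absClosureEmbedding K (v.adicCompletion K) y := by
      intro y hy
      have h1 := toAlgEquiv_symm_liftNormal_smul_coe M σ₁ ⟨absClosureEmbedding K (v.adicCompletion K) y, hιL y hy⟩
      have h2 := toAlgEquiv_symm_liftNormal_smul_coe M σ₂ ⟨absClosureEmbedding K (v.adicCompletion K) y, hιL y hy⟩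
      have h12' := congrArg (fun ρ : L ≃ₐ[K] L ↦
        absClosureEmbedding K (v.adicCompletion K) ((ρ ⟨y, hy⟩ : L) : AlgebraicClosure K)) h12
      simp only [hr] at h12'
      rw [mul_smul, h1, h12', ← h2, inv_smul_smul]
    have hτ := hinj _ hτ₀ hτfix
    ext z
    have hz := (IntermediateField.mem_fixingSubgroup_iff _ _).mp hτ (z : AlgebraicClosure (v.adicCompletion K)) z.2
    change (((absoluteGaloisGroup.toAlgEquiv (v.adicCompletion K)).symm
        (σ₂.liftNormal (AlgebraicClosure (v.adicCompletion K))))⁻¹ *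
        (absoluteGaloisGroup.toAlgEquiv (v.adicCompletion K)).symm
          (σ₁.liftNormal (AlgebraicClosure (v.adicCompletion K)))) • (z : AlgebraicClosure (v.adicCompletion K)) = z at hz
    rw [mul_smul, inv_smul_eq_iff, toAlgEquiv_symm_liftNormal_smul_coe, toAlgEquiv_symm_liftNormal_smul_coe] at hz
    exact hz
  -- `ρ ∈ SL`, so `ρ = r σ` for some `σ ∈ SM` by cardinality
  have hρSL : ρ ∈ SL := by
    rw [hSL, Finset.mem_filter]
    refine ⟨Finset.mem_univ _, fun y ↦ Subtype.ext ?_⟩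
    rw [IntermediateField.coe_inclusion]
    exact hρ _ (by rw [IntermediateField.coe_inclusion]; exact y.2)
  obtain ⟨σ, hσ, hσρ⟩ := Finset.surj_on_of_inj_on_of_card_le (fun σ _ => r σ) (fun σ hσ => hmaps σ hσ)
    (fun σ₁ σ₂ hσ₁ hσ₂ h => hinjr σ₁ hσ₁ σ₂ hσ₂ h) hcard ρ hρSL
  rw [hSM, Finset.mem_filter] at hσ
  refine ⟨(absoluteGaloisGroup.toAlgEquiv (v.adicCompletion K)).symm (σ.liftNormal (AlgebraicClosure (v.adicCompletion K))),
    hσρ.symm, ?_⟩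
  exact (IntermediateField.mem_fixingSubgroup_iff _ _).mpr fun z hz ↦ hfix₀ σ hσ.2 z hz

/-- ★ **`ι(N_{L/L₀} x) = N_{M/M₀}(ι x)` from (INJ) and the count** `#{ρ : ρ|_{L₀} = id} ≤ #{σ : σ|_{M₀} = id}`
(`absClosureEmbedding_towerNorm_eq_towerNorm` with (SURJ) supplied by `exists_absRestrictNormalHom_eq_of_card_le`).
[cite: deShalit1987, II.4.5 (p. 58), III.1.2 (2) (p. 101)] [cite: NeukirchANT1999, Ch. IV §1 (1.2)] -/
theorem absClosureEmbedding_towerNorm_eq_towerNorm_of_card_le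
    (L₀ L : IntermediateField K (AlgebraicClosure K)) [FiniteDimensional K L] [IsGalois K L] (hL : L₀ ≤ L)
    (M₀ M : IntermediateField (v.adicCompletion K) (AlgebraicClosure (v.adicCompletion K)))
    [FiniteDimensional (v.adicCompletion K) M] [IsGalois (v.adicCompletion K) M] (hM : M₀ ≤ M)
    (hιL : ∀ y : AlgebraicClosure K, y ∈ L → absClosureEmbedding K (v.adicCompletion K) y ∈ M)
    (hιL₀ : ∀ y : AlgebraicClosure K, y ∈ L₀ → absClosureEmbedding K (v.adicCompletion K) y ∈ M₀)
    (hinj : ∀ τ : absoluteGaloisGroup (v.adicCompletion K), τ ∈ M₀.fixingSubgroup →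
      (∀ y ∈ L, τ • absClosureEmbedding K (v.adicCompletion K) y = absClosureEmbedding K (v.adicCompletion K) y) →
        τ ∈ M.fixingSubgroup)
    (hcard : (Finset.univ.filter (fun ρ : L ≃ₐ[K] L =>
        ∀ y : L₀, ρ (IntermediateField.inclusion hL y) = IntermediateField.inclusion hL y)).card ≤
      (Finset.univ.filter (fun σ : M ≃ₐ[v.adicCompletion K] M =>
        ∀ y : M₀, σ (IntermediateField.inclusion hM y) = IntermediateField.inclusion hM y)).card)
    (x : L) :
    absClosureEmbedding K (v.adicCompletion K)
        ((@Algebra.norm L₀ L _ _ (towerAlgebra hL) x : L₀) : AlgebraicClosure K) =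
      ((@Algebra.norm M₀ M _ _ (towerAlgebra hM) ⟨absClosureEmbedding K (v.adicCompletion K) x, hιL x x.2⟩ : M₀) :
        AlgebraicClosure (v.adicCompletion K)) :=
  absClosureEmbedding_towerNorm_eq_towerNorm L₀ L hL M₀ M hM hιL hιL₀ hinj
    (exists_absRestrictNormalHom_eq_of_card_le L₀ L hL M₀ M hM hιL hιL₀ hinj hcard) x

/-! ### §3. THE INERT CRITERION: `[E':K_v] ∣ ord(Frob_v ∈ Gal(K(𝔪')/K))` ⟹ `E' ⊆ K_v·ι(K(𝔪'))` (Galois form) -/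

open ValuativeRel in
/-- ★ **If `[E':K_v]` divides the order `f'` of the Frobenius of `v` in `Gal(K(𝔪')/K)` (the residue degree of `K(𝔪')` at `v`),
every `τ ∈ Γ_{K_v}` fixing `ι(K(𝔪'))` pointwise fixes `E'`** (`E' ≤ K_v^{nr}` finite, `𝔪' ≠ 0`, `v ∤ 𝔪'`, `π` a uniformiser):
for a Weil element `w` this is `orderOf_frob_dvd_deg` (`res w ∈ Gal(K̄/K(𝔪')) ⟹ f' ∣ deg w`) and `W ∩ Γ_{E'} = deg⁻¹([E':K_v]ℤ)`
(`mem_fieldSubgroup_iff_dvd_deg_of_le_maxUnramified`); the Weil group is dense in `Γ_{K_v}` and both conditions are open/closed.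
So the unramified step `E ↦ E'` of the local tower is GENERATED by the global field `K(𝔪')` — the step is INERT at `𝔓`.
[cite: NeukirchANT1999, Ch. VI §7 Cor. (7.3), Ch. IV §4] [cite: deShalit1987, II.1.10 (p. 39), II.4.14 (p. 71)] [cite: Corvallis1979, (1.4.1)] -/
theorem mem_fixingSubgroup_of_forall_smul_absClosureEmbedding_eq_of_finrank_dvd_orderOf (h𝔪' : 𝔪' ≠ ⊥)
    (hv' : ¬ 𝔪' ≤ v.asIdeal)
    {π : 𝒪[v.adicCompletion K]} (hπ : (valuation (v.adicCompletion K)).IsUniformizer (π : v.adicCompletion K))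
    (E' : IntermediateField (v.adicCompletion K) (AlgebraicClosure (v.adicCompletion K)))
    [FiniteDimensional (v.adicCompletion K) E'] (hE' : E' ≤ maxUnramified (v.adicCompletion K))
    (hdvd : ((Module.finrank (v.adicCompletion K) E' : ℕ) : ℤ) ∣
      (orderOf (abRestrict (rayClassField K 𝔪')
        (ideleArtinMap K (localUnits v (Units.mk0 (π : v.adicCompletion K) hπ.ne_zero)))) : ℤ))
    {τ : absoluteGaloisGroup (v.adicCompletion K)}
    (hτfix : ∀ x ∈ rayClassField K 𝔪',
      τ • absClosureEmbedding K (v.adicCompletion K) x = absClosureEmbedding K (v.adicCompletion K) x) :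
    τ ∈ E'.fixingSubgroup := by
  haveI : CharZero (v.adicCompletion K) :=
    charZero_of_injective_algebraMap (algebraMap K (v.adicCompletion K)).injective
  have ha := isLocalArtinMap_canonicalArtin_holds (v.adicCompletion K)
  by_contra hcon
  set L := rayClassField K 𝔪' with hL
  have hopen₂ : IsOpen ((fun σ : AlgebraicClosure (v.adicCompletion K) ≃ₐ[v.adicCompletion K]
      AlgebraicClosure (v.adicCompletion K) ↦ absGaloisRestrict K (v.adicCompletion K) σ) ⁻¹'
        (((absRestrictNormalHom L).ker : Subgroup (absoluteGaloisGroup K)) : Set (absoluteGaloisGroup K))) :=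
    (isOpen_ker_absRestrictNormalHom L).preimage (absGaloisRestrict K (v.adicCompletion K)).continuous
  have hopen := hopen₂.inter
    (Subgroup.isClosed_of_isOpen _ (IntermediateField.fixingSubgroup_isOpen E')).isOpen_compl
  have hτ₂ : absGaloisRestrict K (v.adicCompletion K) τ ∈ (absRestrictNormalHom L).ker := by
    refine mem_ker_absRestrictNormalHom_of_forall_smul_eq₁₂ L fun x hx ↦ ?_
    apply (absClosureEmbedding K (v.adicCompletion K)).injective
    have h := hτfix x hx
    rwa [← absGaloisRestrict_apply_smul] at h
  have hd0 := WeilGroup.denseRange_toAbsGalois_holds (v.adicCompletion K)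
  dsimp only [WeilGroup.denseRange_toAbsGalois] at hd0
  have hd : DenseRange (fun w : WeilGroup (v.adicCompletion K) ↦
      absoluteGaloisGroup.toAlgEquiv (v.adicCompletion K) (WeilGroup.toAbsGalois (v.adicCompletion K) w)) := hd0
  obtain ⟨w, ⟨hwL, hwE'⟩⟩ := hd.exists_mem_open hopen
    ⟨absoluteGaloisGroup.toAlgEquiv (v.adicCompletion K) τ, ⟨hτ₂, hcon⟩⟩
  apply hwE'
  -- `f' ∣ deg w` and `[E':K_v] ∣ f'`, so `w` fixes `E'`
  have hfw := orderOf_frob_dvd_deg (𝔪 := 𝔪') h𝔪' hv' ha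
    (ϖ := Units.mk0 (π : v.adicCompletion K) hπ.ne_zero) hπ w hwL
  have hwfield : w ∈ LocalWeilDatum.fieldSubgroup (v.adicCompletion K) E' :=
    (mem_fieldSubgroup_iff_dvd_deg_of_le_maxUnramified hE' w).mpr (hdvd.trans hfw)
  rw [LocalWeilDatum.mem_fieldSubgroup_iff] at hwfield
  exact (IntermediateField.mem_fixingSubgroup_iff _ _).mpr fun x hx ↦ hwfield x hx

/-! ### §4. THE NORM COMPATIBILITY in the unramified direction -/

variable [IsTotallyComplex K]

open ValuativeRel in
/-- ★★ **`ι(N_{K(𝔪'v^{n+1})/K(𝔪v^{n+1})} x) = N_{E'·K_π^{n+1}/E·K_π^{n+1}}(ι x)`** — global norms are local norms in the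
UNRAMIFIED direction.  Setting: `K` totally complex; `𝔪' ≤ 𝔪` non-zero ideals with `v ∤ 𝔪'`; ONE uniformiser `π`
of `K_v` with `α = π^f`, `α ≡ 1 mod 𝔪`, `α' = π^{f'}`, `α' ≡ 1 mod 𝔪'` (`α, α' ∈ 𝓞_K` units off `v`); `E ≤ E'` finite Galois
with `E' ≤ K_v^{nr}`, `f ∣ deg w` (resp. `f' ∣ deg w`) for the Weil elements fixing `E` (resp. `E'`).  HYPOTHESES: (INERT)
every `τ ∈ Γ_{K_v}` fixing `ι(K(𝔪'))` pointwise fixes `E'`; (COUNT) `[K(𝔪'v^{n+1}) : K(𝔪v^{n+1})]·[E:K_v] ≤ [E':K_v]`.  Both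
norms are Mathlib's `Algebra.norm` for the tower algebras; the proof is (INJ) — `τ` fixing `E·K_π^{n+1}` and `ι(K(𝔪'v^{n+1}))`
fixes `E'` by (INERT) and `K_π^{n+1}`, hence `E'·K_π^{n+1}` — plus the count
`#Gal(E'K_π^{n+1}/EK_π^{n+1}) = [E':E]` (`finrank_sup_ltField_of_le_maxUnramified`).  This is the `baseNorm`-coherence input
for two-variable families of GLOBAL units (de Shalit II.4.14: `μ(𝔤𝔭̄^{m}𝔭^∞)` glued along `m`; III.1.1 `U_∞ = lim U_{m,k}`).
[cite: deShalit1987, II.4.14 Step 1 (p. 71), III.1.1–1.2 (2) (p. 88–89, 101), II.1.10 (p. 39)] [cite: NeukirchANT1999, Ch. IV §1 (1.2)] -/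
theorem absClosureEmbedding_towerNorm_rayClassField_unramified_eq (h𝔪 : 𝔪 ≠ ⊥) (h𝔪' : 𝔪' ≠ ⊥) (hle : 𝔪' ≤ 𝔪)
    (hv' : ¬ 𝔪' ≤ v.asIdeal)
    {π : 𝒪[v.adicCompletion K]} (hπ : (valuation (v.adicCompletion K)).IsUniformizer (π : v.adicCompletion K))
    {α : 𝓞 K} (hα0 : α ≠ 0) (hα𝔪 : α - 1 ∈ 𝔪) (hαw : ∀ w : HeightOneSpectrum (𝓞 K), w ≠ v → α ∉ w.asIdeal)
    {f : ℕ} (hαπ : ((α : K) : v.adicCompletion K) = (π : v.adicCompletion K) ^ f)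
    {α' : 𝓞 K} (hα'0 : α' ≠ 0) (hα'𝔪 : α' - 1 ∈ 𝔪') (hα'w : ∀ w : HeightOneSpectrum (𝓞 K), w ≠ v → α' ∉ w.asIdeal)
    {f' : ℕ} (hα'π : ((α' : K) : v.adicCompletion K) = (π : v.adicCompletion K) ^ f')
    (E E' : IntermediateField (v.adicCompletion K) (AlgebraicClosure (v.adicCompletion K)))
    [FiniteDimensional (v.adicCompletion K) E] [IsGalois (v.adicCompletion K) E]
    [FiniteDimensional (v.adicCompletion K) E'] [IsGalois (v.adicCompletion K) E'] (hEE' : E ≤ E')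
    (hE' : E' ≤ maxUnramified (v.adicCompletion K))
    (hdegE : ∀ w : WeilGroup (v.adicCompletion K),
      WeilGroup.toAbsGalois (v.adicCompletion K) w ∈ E.fixingSubgroup → (f : ℤ) ∣ WeilGroup.deg w)
    (hdegE' : ∀ w : WeilGroup (v.adicCompletion K),
      WeilGroup.toAbsGalois (v.adicCompletion K) w ∈ E'.fixingSubgroup → (f' : ℤ) ∣ WeilGroup.deg w)
    (hinert : ∀ τ : absoluteGaloisGroup (v.adicCompletion K),
      (∀ x ∈ rayClassField K 𝔪', τ • absClosureEmbedding K (v.adicCompletion K) x = absClosureEmbedding K (v.adicCompletion K) x) →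
        τ ∈ E'.fixingSubgroup)
    (n : ℕ)
    (hcount : IntermediateField.relfinrank (rayClassField K (𝔪 * v.asIdeal ^ (n + 1))) (rayClassField K (𝔪' * v.asIdeal ^ (n + 1))) *
      Module.finrank (v.adicCompletion K) E ≤ Module.finrank (v.adicCompletion K) E')
    (x : rayClassField K (𝔪' * v.asIdeal ^ (n + 1))) :
    absClosureEmbedding K (v.adicCompletion K)
        ((@Algebra.norm (rayClassField K (𝔪 * v.asIdeal ^ (n + 1))) (rayClassField K (𝔪' * v.asIdeal ^ (n + 1))) _ _
            (towerAlgebra (rayClassField_le_of_le (mul_ne_zero h𝔪' (pow_ne_zero _ v.ne_bot)) (Ideal.mul_mono_left hle))) x :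
          rayClassField K (𝔪 * v.asIdeal ^ (n + 1))) : AlgebraicClosure K) =
      ((@Algebra.norm (E ⊔ ltField π n : IntermediateField (v.adicCompletion K) (AlgebraicClosure (v.adicCompletion K)))
            (E' ⊔ ltField π n : IntermediateField (v.adicCompletion K) (AlgebraicClosure (v.adicCompletion K))) _ _
            (towerAlgebra (sup_le_sup_right hEE' (ltField π n)))
            ⟨absClosureEmbedding K (v.adicCompletion K) x,
              absClosureEmbedding_mem_sup_ltField_of_mem_rayClassField_mul_pow h𝔪' hv' hπ hα'0 hα'𝔪 hα'w hα'π E' hdegE' n x.2⟩ :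
          (E ⊔ ltField π n : IntermediateField (v.adicCompletion K) (AlgebraicClosure (v.adicCompletion K)))) :
        AlgebraicClosure (v.adicCompletion K)) := by
  have hv : ¬ 𝔪 ≤ v.asIdeal := fun h ↦ hv' (hle.trans h)
  have hE : E ≤ maxUnramified (v.adicCompletion K) := hEE'.trans hE'
  haveI : FiniteDimensional (v.adicCompletion K)
      (E' ⊔ ltField π n : IntermediateField (v.adicCompletion K) (AlgebraicClosure (v.adicCompletion K))) :=
    IntermediateField.finiteDimensional_sup E' (ltField π n)
  haveI : IsGalois (v.adicCompletion K)
      (E' ⊔ ltField π n : IntermediateField (v.adicCompletion K) (AlgebraicClosure (v.adicCompletion K))) :=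
    isGalois_sup_ltField hπ E' n
  haveI : FiniteDimensional (v.adicCompletion K)
      (E ⊔ ltField π n : IntermediateField (v.adicCompletion K) (AlgebraicClosure (v.adicCompletion K))) :=
    IntermediateField.finiteDimensional_sup E (ltField π n)
  have hLle : rayClassField K (𝔪 * v.asIdeal ^ (n + 1)) ≤ rayClassField K (𝔪' * v.asIdeal ^ (n + 1)) :=
    rayClassField_le_of_le (mul_ne_zero h𝔪' (pow_ne_zero _ v.ne_bot)) (Ideal.mul_mono_left hle)
  have hMle : (E ⊔ ltField π n : IntermediateField (v.adicCompletion K) (AlgebraicClosure (v.adicCompletion K))) ≤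
      E' ⊔ ltField π n := sup_le_sup_right hEE' (ltField π n)
  refine absClosureEmbedding_towerNorm_eq_towerNorm_of_card_le (rayClassField K (𝔪 * v.asIdeal ^ (n + 1)))
    (rayClassField K (𝔪' * v.asIdeal ^ (n + 1))) hLle (E ⊔ ltField π n) (E' ⊔ ltField π n) hMle
    (fun y hy ↦ absClosureEmbedding_mem_sup_ltField_of_mem_rayClassField_mul_pow h𝔪' hv' hπ hα'0 hα'𝔪 hα'w hα'π E' hdegE' n hy)
    (fun y hy ↦ absClosureEmbedding_mem_sup_ltField_of_mem_rayClassField_mul_pow h𝔪 hv hπ hα0 hα𝔪 hαw hαπ E hdegE n hy)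
    (fun τ hτ₀ hτfix ↦ ?_) ?_ x
  · -- (INJ): `τ` fixes `K_π^{n+1}` (inside `E ⊔ K_π^{n+1}`) and `E'` (inert hypothesis, `K(𝔪') ⊆ K(𝔪'v^{n+1})`)
    have hτE' : τ ∈ E'.fixingSubgroup :=
      hinert τ fun y hy ↦ hτfix y (rayClassField_le_of_le (mul_ne_zero h𝔪' (pow_ne_zero _ v.ne_bot)) Ideal.mul_le_right hy)
    have hτπ : τ ∈ (ltField π n).fixingSubgroup := IntermediateField.fixingSubgroup_antitone le_sup_right hτ₀
    rw [IntermediateField.fixingSubgroup_sup]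
    exact ⟨hτE', hτπ⟩
  · -- (COUNT): `#Gal(L/L₀)·[L₀:K] = [L:K]`, `#Gal(M/M₀)·[M₀:K_v] = [M:K_v] = [E':K_v][K_π^{n+1}:K_v]`
    have hcL := card_filter_fixing_mul_finrank (F := K) hLle
    have hcM := card_filter_fixing_mul_finrank (F := v.adicCompletion K) hMle
    rw [finrank_sup_ltField_of_le_maxUnramified hπ E hE n, finrank_sup_ltField_of_le_maxUnramified hπ E' hE' n] at hcM
    have hrel := IntermediateField.finrank_bot_mul_relfinrank hLle
    -- abbreviate
    set cL := (Finset.univ.filter (fun ρ : (rayClassField K (𝔪' * v.asIdeal ^ (n + 1))) ≃ₐ[K]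
        (rayClassField K (𝔪' * v.asIdeal ^ (n + 1))) =>
        ∀ y : rayClassField K (𝔪 * v.asIdeal ^ (n + 1)), ρ (IntermediateField.inclusion hLle y) = IntermediateField.inclusion hLle y)).card
    set cM := (Finset.univ.filter (fun σ : (E' ⊔ ltField π n : IntermediateField (v.adicCompletion K)
        (AlgebraicClosure (v.adicCompletion K))) ≃ₐ[v.adicCompletion K]
        (E' ⊔ ltField π n : IntermediateField (v.adicCompletion K) (AlgebraicClosure (v.adicCompletion K))) =>
        ∀ y : (E ⊔ ltField π n : IntermediateField (v.adicCompletion K) (AlgebraicClosure (v.adicCompletion K))),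
          σ (IntermediateField.inclusion hMle y) = IntermediateField.inclusion hMle y)).card
    have hL0 : 0 < Module.finrank K (rayClassField K (𝔪 * v.asIdeal ^ (n + 1))) := Module.finrank_pos
    have hE0 : 0 < Module.finrank (v.adicCompletion K) E := Module.finrank_pos
    have hπ0 : 0 < Module.finrank (v.adicCompletion K) (ltField π n) := Module.finrank_pos
    -- `cL = relfinrank L₀ L`
    have hcL' : cL = IntermediateField.relfinrank (rayClassField K (𝔪 * v.asIdeal ^ (n + 1)))
        (rayClassField K (𝔪' * v.asIdeal ^ (n + 1))) := by
      apply Nat.eq_of_mul_eq_mul_left hL0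
      rw [hrel, ← hcL, mul_comm]
    -- `cM * [E:K_v] = [E':K_v]`
    have hcM' : cM * Module.finrank (v.adicCompletion K) E = Module.finrank (v.adicCompletion K) E' := by
      apply Nat.eq_of_mul_eq_mul_right hπ0
      rw [mul_assoc, hcM]
    calc cL = cL * Module.finrank (v.adicCompletion K) E / Module.finrank (v.adicCompletion K) E :=
          (Nat.mul_div_cancel cL hE0).symm
      _ ≤ Module.finrank (v.adicCompletion K) E' / Module.finrank (v.adicCompletion K) E :=
          Nat.div_le_div_right (by rw [hcL']; exact hcount)
      _ = cM := by rw [← hcM', Nat.mul_div_cancel cM hE0]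

open ValuativeRel in
/-- ★★ **The norm compatibility in the unramified direction with the inert hypothesis discharged by the residue degree**:
if `[E':K_v] ∣ ord(Frob_v ∈ Gal(K(𝔪')/K))` (§3) and `[K(𝔪'v^{n+1}) : K(𝔪v^{n+1})]·[E:K_v] ≤ [E':K_v]`, then
`ι(N_{K(𝔪'v^{n+1})/K(𝔪v^{n+1})} x) = N_{E'·K_π^{n+1}/E·K_π^{n+1}}(ι x)`.
[cite: deShalit1987, II.4.14 Step 1 (p. 71), III.1.2 (2) (p. 101)] [cite: NeukirchANT1999, Ch. VI §7 Cor. (7.3), Ch. IV §4] -/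
theorem absClosureEmbedding_towerNorm_rayClassField_unramified_eq_of_finrank_dvd_orderOf (h𝔪 : 𝔪 ≠ ⊥) (h𝔪' : 𝔪' ≠ ⊥)
    (hle : 𝔪' ≤ 𝔪) (hv' : ¬ 𝔪' ≤ v.asIdeal)
    {π : 𝒪[v.adicCompletion K]} (hπ : (valuation (v.adicCompletion K)).IsUniformizer (π : v.adicCompletion K))
    {α : 𝓞 K} (hα0 : α ≠ 0) (hα𝔪 : α - 1 ∈ 𝔪) (hαw : ∀ w : HeightOneSpectrum (𝓞 K), w ≠ v → α ∉ w.asIdeal)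
    {f : ℕ} (hαπ : ((α : K) : v.adicCompletion K) = (π : v.adicCompletion K) ^ f)
    {α' : 𝓞 K} (hα'0 : α' ≠ 0) (hα'𝔪 : α' - 1 ∈ 𝔪') (hα'w : ∀ w : HeightOneSpectrum (𝓞 K), w ≠ v → α' ∉ w.asIdeal)
    {f' : ℕ} (hα'π : ((α' : K) : v.adicCompletion K) = (π : v.adicCompletion K) ^ f')
    (E E' : IntermediateField (v.adicCompletion K) (AlgebraicClosure (v.adicCompletion K)))
    [FiniteDimensional (v.adicCompletion K) E] [IsGalois (v.adicCompletion K) E]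
    [FiniteDimensional (v.adicCompletion K) E'] [IsGalois (v.adicCompletion K) E'] (hEE' : E ≤ E')
    (hE' : E' ≤ maxUnramified (v.adicCompletion K))
    (hdegE : ∀ w : WeilGroup (v.adicCompletion K),
      WeilGroup.toAbsGalois (v.adicCompletion K) w ∈ E.fixingSubgroup → (f : ℤ) ∣ WeilGroup.deg w)
    (hdegE' : ∀ w : WeilGroup (v.adicCompletion K),
      WeilGroup.toAbsGalois (v.adicCompletion K) w ∈ E'.fixingSubgroup → (f' : ℤ) ∣ WeilGroup.deg w)
    (hdvd : ((Module.finrank (v.adicCompletion K) E' : ℕ) : ℤ) ∣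
      (orderOf (abRestrict (rayClassField K 𝔪')
        (ideleArtinMap K (localUnits v (Units.mk0 (π : v.adicCompletion K) hπ.ne_zero)))) : ℤ))
    (n : ℕ)
    (hcount : IntermediateField.relfinrank (rayClassField K (𝔪 * v.asIdeal ^ (n + 1))) (rayClassField K (𝔪' * v.asIdeal ^ (n + 1))) *
      Module.finrank (v.adicCompletion K) E ≤ Module.finrank (v.adicCompletion K) E')
    (x : rayClassField K (𝔪' * v.asIdeal ^ (n + 1))) :
    absClosureEmbedding K (v.adicCompletion K)
        ((@Algebra.norm (rayClassField K (𝔪 * v.asIdeal ^ (n + 1))) (rayClassField K (𝔪' * v.asIdeal ^ (n + 1))) _ _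
            (towerAlgebra (rayClassField_le_of_le (mul_ne_zero h𝔪' (pow_ne_zero _ v.ne_bot)) (Ideal.mul_mono_left hle))) x :
          rayClassField K (𝔪 * v.asIdeal ^ (n + 1))) : AlgebraicClosure K) =
      ((@Algebra.norm (E ⊔ ltField π n : IntermediateField (v.adicCompletion K) (AlgebraicClosure (v.adicCompletion K)))
            (E' ⊔ ltField π n : IntermediateField (v.adicCompletion K) (AlgebraicClosure (v.adicCompletion K))) _ _
            (towerAlgebra (sup_le_sup_right hEE' (ltField π n)))
            ⟨absClosureEmbedding K (v.adicCompletion K) x,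
              absClosureEmbedding_mem_sup_ltField_of_mem_rayClassField_mul_pow h𝔪' hv' hπ hα'0 hα'𝔪 hα'w hα'π E' hdegE' n x.2⟩ :
          (E ⊔ ltField π n : IntermediateField (v.adicCompletion K) (AlgebraicClosure (v.adicCompletion K)))) :
        AlgebraicClosure (v.adicCompletion K)) :=
  absClosureEmbedding_towerNorm_rayClassField_unramified_eq h𝔪 h𝔪' hle hv' hπ hα0 hα𝔪 hαw hαπ hα'0 hα'𝔪 hα'w hα'π E E'
    hEE' hE' hdegE hdegE' (fun _ hτ ↦ mem_fixingSubgroup_of_forall_smul_absClosureEmbedding_eq_of_finrank_dvd_orderOf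
      h𝔪' hv' hπ E' hE' hdvd hτ) n hcount x

end Literature.NumberTheory.NumberFields

end
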